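import Literature.AnabelianGeometry.AbsoluteAnabelian.MLFGaloisUnitsEndomorphismsArePowers
import Literature.AnabelianGeometry.AbsoluteAnabelian.MLFGaloisPairs
import HarnessLib

/-!
# `TF`: a `G_k`-equivariant ring endomorphism of `k̄` over `id_{G_k}` is the identity; endomorphisms of the model
# `TF`-pair `(Π_k ↷ k̄)` covering the identity of `G_k` are `T`-isomorphisms with `φ_M = id`

Proof-only sequel (theorems only, no definitions) of `MLFGaloisUnitsEndomorphismsArePowers.lean` (abc-iut-L4-t2 gen 11:
an equivariant group endomorphism of `k̄^×` over `id_{G_k}` is `x ↦ xᴹ`, `M ∈ ℤ`); S. Mochizuki, *Topics in Absolute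
Anabelian Geometry III*, Def. 3.1 (ii)/(iii) p. 67 (MLF-Galois `TF`-pairs `(Π ↷ k̄)`; morphisms: a ring homomorphism
`φ_M` compatible with a `φ_Π` inducing an open injection of arithmetic Galois groups; "`T`-isomorphism" = `φ_M`
bijective) and Prop. 3.2 (iv) p. 72 (injectivity `Isom((Π ↷ M_T),(Π* ↷ M*_T)) ↪ Isom(Π, Π*)`; bib key
`MochizukiAbsTopIII2015`, lit key `paper:url-5493eb38cbb7`).

* `MLFClosure.ringHom_eq_id_of_equivariant` — **a `G_k`-equivariant RING endomorphism `φ` of `k̄` over `id_{G_k}` is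
  the identity**: restricted to `k̄^×`, `φ` is an equivariant group endomorphism, hence `x ↦ xᴹ`
  (`MLFClosure.nonZeroDivisors_monoidHom_eq_zpow`); additivity at `1 + 1` gives `2ᴹ = 2`, so `M = 1`.  This is the
  `TF` member of the tetralogy `End_{id}` of the model `TF / TM / TLG / TCG` objects `= {1} ⊂ ℕ ⊂ ℤ ⊂ Ẑ`
  (`MonoidKummerEndomorphismsArePowers` / `MLFGaloisUnitsEndomorphismsArePowers` /
  `AbsTopIII/EquivariantUnitEndomorphisms`); the `≃` case is abc-iut-w4-d045's `fieldPairIsoDeterminedByGalois_holds`;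
* for an ENDOMORPHISM `φ = (φ_Π, φ_M)` of the model `TF`-pair `D.fieldPair = (Π_k ↷ k̄)` (`MLFGaloisPairs.lean`) in the
  typed category `𝒞^MLF_TF` COVERING THE IDENTITY of `G_k` (`ε ∘ φ_Π = ε`):
  `GaloisFieldPair.Hom.tf_homM_equivariant_of_overId` (`φ_M` commutes with `Gal(k̄/k)`),
  `GaloisFieldPair.Hom.tf_homM_eq_id_of_overId` (**`φ_M = id_{k̄}`**), `…tf_homM_apply_of_overId`,
  `GaloisFieldPair.Hom.tf_isTIso_of_overId` (every such endomorphism is a `T`-isomorphism).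

HONEST FRAMING: OUR kernel check of a classical statement about a `p`-adic field and its algebraic closure;
count-neutral for the nodes Prop. 3.2 (iv) / 3.3 (ii); nothing here bears on [IUTchIII] Cor. 3.12; no side is
taken; nothing asserts that abc is proved or refuted.
-/

noncomputable section

open scoped Classical

namespace Literature.AnabelianGeometry.AbsoluteAnabelian

universe u

namespace MLFClosure

variable {C : MLFClosure.{u}}

/-- `2 ∈ k̄^×` (characteristic `0`). [folklore] -/
private theorem two_mem_nonZeroDivisors' : (2 : C.K) ∈ nonZeroDivisors C.K :=
  mem_nonZeroDivisors_of_ne_zero (by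
    haveI : CharZero C.K := charZero_of_injective_algebraMap (algebraMap C.k C.K).injective; exact two_ne_zero)

/-- In characteristic `0`, `2 ^ d = 1` (`d ∈ ℤ`) forces `d = 0` (copy of the private lemma of
`MLFGaloisUnitsEndomorphismsArePowers.lean`). [folklore] -/
private theorem eq_zero_of_two_zpow_eq_one' {d : ℤ} (h : (2 : C.K) ^ d = 1) : d = 0 := by
  haveI : CharZero C.K := charZero_of_injective_algebraMap (algebraMap C.k C.K).injective
  have key : ∀ n : ℕ, (2 : C.K) ^ n = 1 → n = 0 := by
    intro n hn
    have hcast : ((2 ^ n : ℕ) : C.K) = ((2 ^ 0 : ℕ) : C.K) := by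
      rw [Nat.cast_pow, Nat.cast_pow, Nat.cast_ofNat, hn, pow_zero]
    exact Nat.pow_right_injective (le_refl 2) (Nat.cast_injective hcast)
  rcases le_or_gt 0 d with hd | hd
  · have h1 : (2 : C.K) ^ d.toNat = 1 := by rw [← zpow_natCast, Int.toNat_of_nonneg hd]; exact h
    have := key d.toNat h1
    omega
  · have h1 : (2 : C.K) ^ (-d).toNat = 1 := by
      rw [← zpow_natCast, Int.toNat_of_nonneg (by omega), zpow_neg, h, inv_one]
    have := key (-d).toNat h1
    omega

/-- **`TF`: a `G_k`-equivariant RING endomorphism of `k̄` over `id_{G_k}` is the IDENTITY** — the model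
`TF`-object `(G_k ↷ k̄)` of Def. 3.1 (ii)/(iii) is rigid even for ENDOmorphisms: restricted to `k̄^×`, `φ` is an
equivariant group endomorphism, hence `x ↦ xᴹ` (`nonZeroDivisors_monoidHom_eq_zpow`); additivity at `1 + 1`
gives `2ᴹ = 2`, so `M = 1`.  Completes the tetralogy `End_{id}` of the model `TF / TM / TLG / TCG` objects
`= {1} ⊂ ℕ ⊂ ℤ ⊂ Ẑ`; the `≃` case is abc-iut-w4-d045's `fieldPairIsoDeterminedByGalois_holds`.
[cite: MochizukiAbsTopIII2015, Proposition 3.2 (iv) p.72] -/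
theorem ringHom_eq_id_of_equivariant (φ : C.K →+* C.K)
    (hφ : ∀ (σ : C.K ≃ₐ[C.k] C.K) (x : C.K), φ (σ x) = σ (φ x)) : φ = RingHom.id C.K := by
  haveI : CharZero C.K := charZero_of_injective_algebraMap (algebraMap C.k C.K).injective
  have hinj : Function.Injective φ := φ.injective
  let γ : ↥(nonZeroDivisors C.K) →* ↥(nonZeroDivisors C.K) :=
    { toFun := fun x => ⟨φ x, mem_nonZeroDivisors_of_ne_zero
        ((map_ne_zero_iff φ hinj).mpr (nonZeroDivisors.coe_ne_zero x))⟩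
      map_one' := Subtype.ext (by simp)
      map_mul' := fun a b => Subtype.ext (by simp) }
  have hγv : ∀ x : ↥(nonZeroDivisors C.K), (γ x : C.K) = φ x := fun x => rfl
  have hγ : ∀ (σ : C.K ≃ₐ[C.k] C.K) (x : ↥(nonZeroDivisors C.K)),
      (γ ⟨σ • (x : C.K), smul_mem_nonZeroDivisors σ x.2⟩ : C.K) = σ • (γ x : C.K) := by
    intro σ x
    show φ (σ • (x : C.K)) = σ • φ x
    rw [AlgEquiv.smul_def, AlgEquiv.smul_def, hφ]
  obtain ⟨M, hM⟩ := nonZeroDivisors_monoidHom_eq_zpow γ hγ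
  have h2 : (2 : C.K) ^ M = 2 := by
    have h := hM ⟨2, two_mem_nonZeroDivisors'⟩
    rw [hγv] at h
    exact h.symm.trans (map_ofNat φ 2)
  have hM1 : M = 1 := by
    have h := eq_zero_of_two_zpow_eq_one' (C := C) (d := M - 1)
      (by rw [zpow_sub_one₀ two_ne_zero, h2, mul_inv_cancel₀ (two_ne_zero : (2 : C.K) ≠ 0)])
    omega
  refine RingHom.ext fun x => ?_
  by_cases hx : x = 0
  · rw [hx, map_zero, RingHom.id_apply]
  · have h := hM ⟨x, mem_nonZeroDivisors_of_ne_zero hx⟩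
    rw [hγv, hM1, zpow_one] at h
    rw [RingHom.id_apply]
    exact h

end MLFClosure

/-! ## Endomorphisms of the model `TF`-pair covering the identity of `G_k` -/

namespace GaloisFieldPair.Hom

variable {C : MLFClosure.{u}} {D : ModelMLFGaloisData C.k C.K}
  (φ : GaloisFieldPair.Hom D.fieldPair D.fieldPair) (hφ : ∀ g : D.Pi, D.aug (φ.homPi g) = D.aug g)

include hφ in
/-- Over `id_{G_k}`, the field component `φ_M : k̄ →+* k̄` commutes with `Gal(k̄/k)`.
[cite: MochizukiAbsTopIII2015, Definition 3.1 (ii) p.67] -/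
theorem tf_homM_equivariant_of_overId (σ : C.K ≃ₐ[C.k] C.K) (x : C.K) :
    (φ.homM : C.K →+* C.K) (σ x) = σ ((φ.homM : C.K →+* C.K) x) := by
  obtain ⟨g, rfl⟩ := D.aug_surjective σ
  -- `φ_M (g • x) = φ_Π(g) • φ_M x`, the actions being through `ε = D.aug`
  have h : (φ.homM : C.K →+* C.K) (D.aug g x) = D.aug (φ.homPi g) ((φ.homM : C.K →+* C.K) x) :=
    φ.smul_comm g x
  rw [hφ] at h
  exact h

include hφ in
/-- **Over `id_{G_k}`, `φ_M = id_{k̄}`**: an endomorphism of the model `TF`-pair covering the identity of `G_k` has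
trivial field component (`MLFClosure.ringHom_eq_id_of_equivariant`: on `k̄^×` it is `x ↦ xᴹ`, and additivity forces
`M = 1`). [cite: MochizukiAbsTopIII2015, Proposition 3.2 (iv) p.72] -/
theorem tf_homM_eq_id_of_overId : (φ.homM : C.K →+* C.K) = RingHom.id C.K :=
  MLFClosure.ringHom_eq_id_of_equivariant (C := C) (φ.homM : C.K →+* C.K) (tf_homM_equivariant_of_overId φ hφ)

include hφ in
/-- Over `id_{G_k}`, `φ_M x = x` for every `x ∈ k̄`. [cite: MochizukiAbsTopIII2015, Proposition 3.2 (iv) p.72] -/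
theorem tf_homM_apply_of_overId (x : C.K) : (φ.homM : C.K →+* C.K) x = x := by
  have h := RingHom.congr_fun (tf_homM_eq_id_of_overId φ hφ) x
  exact h.trans rfl

include hφ in
/-- **Over `id_{G_k}`, every endomorphism of the model `TF`-pair is a `T`-isomorphism** (Def. 3.1 (ii): `φ_M`
bijective) — indeed `φ_M = id`. [cite: MochizukiAbsTopIII2015, Definition 3.1 (ii) p.67] -/
theorem tf_isTIso_of_overId : φ.IsTIso := by
  show Function.Bijective (φ.homM : C.K →+* C.K)
  refine ⟨fun a b h => ?_, fun y => ⟨y, tf_homM_apply_of_overId φ hφ y⟩⟩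
  rwa [tf_homM_apply_of_overId φ hφ a, tf_homM_apply_of_overId φ hφ b] at h

end GaloisFieldPair.Hom

end Literature.AnabelianGeometry.AbsoluteAnabelian

end
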